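import Summits.AtomisticToContinuum.HydrodynamicLimit.Theorems.RelayRaceLocalityLightConeInLawSVCLine
import Summits.AtomisticToContinuum.HydrodynamicLimit.Theorems.RelayRaceLocalityNearConstantShortTimeHLGeneralFamilyFreeEnergy
import Literature.MathematicalPhysics.KineticTheory.HardSphereEulerProofs

/-!
# Stub `stub_countIVT` of the line `susceptibility-variance-continuity` for the crux `LightConeInLaw`
(stmt-AtomisticToContinuum-12500; route `RelayRaceLocality`, sub-problem `HydrodynamicLimit`)

**Every centre of the mean-count window is a mean count.** For the Poissonised count law
`p_{N,μ}(n) ∝ μⁿ Z_{N,n}/n!` of the hard-sphere gas of diameter `hsDiameter σ₁ N` with local Gibbs profile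
`(a₂, u₂, θ₂)` (vocabulary `canonicalWeights`, `meanCount` of `…LightConeInLawSVCLine`), for `σ₁, σ₂ < σ₀ := 1/4`,
`κ := 1/2` and every `N`, every `mc ∈ [(1−κ)(σ₂/σ₁)³(N+1), (1+κ)(σ₂/σ₁)³(N+1)]` equals
`meanCount σ₁ (localGibbsProfile a₂ u₂ θ₂) μ N` for some activity `μ > 0`.

Proof. Abstractly, for weights `w ≥ 0` on `ℕ` with `w 0 > 0`, `Σ wₙ rⁿ < ∞` for all `r > 0` and `w m₀ > 0`:
the family mean `ν ↦ Σ n wₙ νⁿ / Σ wₙ νⁿ` is continuous on every `[ν₋, ν₊] ⊂ (0, ∞)` (two locally uniformly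
convergent power series, positive denominator), is `≤ ν Σ n wₙ / w 0` for `ν ≤ 1`, and is `≥ U` whenever
`U + 1 ≤ m₀`, `ν ≥ 1` and `U Σ_{n<m₀} wₙ ≤ w m₀ ν` (split the two series at `m₀`); the intermediate value theorem
gives every value in `[L, U]`, `0 < L`. For the hard-sphere weights `wₙ = Z_pos(a₂, ε, n)/n!`
(`canonicalPartition_eq_posPartition`): `w ≥ 0`, `w 0 = 1`, `wₙ ≤ (sup a₂)ⁿ/n!`, and `w (k+1) > 0` for
`k = ⌈(1+κ)(σ₂/σ₁)³(N+1)⌉₊` because `k + 1` spheres of diameter `hsDiameter σ₁ N ≤ hsDiameter (1/2) k` fit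
(`posPartition_pos` at reduced diameter `1/2` and `posPartition_antitone_diam`; this is where `σ₀ = 1/4`,
`κ ≤ 1` enter). References: folklore (exponential families / grand-canonical ensemble, e.g. Ruelle 1969 §3.4).
-/

namespace Summit.AtomisticToContinuum.HydrodynamicLimit.Theorems.LightConeInLawSVC.CountIVT

open scoped BigOperators Topology Classical ENNReal
open Filter Set MeasureTheory
open Literature.MathematicalPhysics.KineticTheory Literature.Analysis.FluidPDE Literature.Analysis.FunctionSpaces
open Summit.AtomisticToContinuum.HydrodynamicLimit.Theorems.LightConeInLawSketch
open Summit.AtomisticToContinuum.HydrodynamicLimit.Theorems.LightConeInLawSVC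

noncomputable section

/-! ### Exponential families of weights on `ℕ`: continuity, small and large parameter, IVT -/

section Abstract

variable {w : ℕ → ℝ}

/-- An entire weight series stays summable after multiplication by `n` (compare with `wₙ (2r)ⁿ`, as `n ≤ 2ⁿ`).
[folklore] -/
theorem summable_mul_pow_mul_nat (hw : ∀ n, 0 ≤ w n)
    (hs : ∀ r : ℝ, 0 < r → Summable fun n => w n * r ^ n) {r : ℝ} (hr : 0 < r) :
    Summable fun n => w n * r ^ n * (n : ℝ) := by
  refine Summable.of_nonneg_of_le (fun n => by have := hw n; positivity) (fun n => ?_)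
    (hs (2 * r) (by positivity))
  have h2 : (n : ℝ) ≤ 2 ^ n := by exact_mod_cast Nat.lt_two_pow_self.le
  calc w n * r ^ n * (n : ℝ) ≤ w n * r ^ n * 2 ^ n :=
        mul_le_mul_of_nonneg_left h2 (by have := hw n; positivity)
    _ = w n * (2 * r) ^ n := by rw [mul_pow]; ring

/-- The family mean is the ratio of the two series `Σ wₙ νⁿ g n` and `Σ wₙ νⁿ`. [folklore] -/
theorem wMean_eq_tsum_div_wZ (w g : ℕ → ℝ) (ν : ℝ) :
    wMean w g ν = (∑' n, w n * ν ^ n * g n) / wZ w ν := by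
  unfold wMean wP
  rw [← tsum_div_const]
  exact tsum_congr fun n => by ring

/-- Continuity of `ν ↦ Σ wₙ νⁿ g n` on `[0, R]` when `Σ wₙ Rⁿ |g n| < ∞` (Weierstrass M-test). [folklore] -/
theorem continuousOn_tsum_weights (hw : ∀ n, 0 ≤ w n) (g : ℕ → ℝ) {R : ℝ}
    (hs : Summable fun n => w n * R ^ n * |g n|) :
    ContinuousOn (fun ν => ∑' n, w n * ν ^ n * g n) (Icc 0 R) := by
  refine continuousOn_tsum (fun n => ?_) hs (fun n ν hν => ?_)
  · fun_prop
  · rw [Real.norm_eq_abs, abs_mul, abs_mul, abs_of_nonneg (hw n), abs_of_nonneg (pow_nonneg hν.1 n)]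
    exact mul_le_mul_of_nonneg_right
      (mul_le_mul_of_nonneg_left (pow_le_pow_left₀ hν.1 hν.2 n) (hw n)) (abs_nonneg _)

/-- The partition sum dominates its constant term: `w 0 ≤ Σ wₙ νⁿ` for `ν > 0`. [folklore] -/
theorem w_zero_le_wZ (hw : ∀ n, 0 ≤ w n) (hs : ∀ r : ℝ, 0 < r → Summable fun n => w n * r ^ n)
    {ν : ℝ} (hν : 0 < ν) : w 0 ≤ wZ w ν := by
  have h := (hs ν hν).le_tsum 0 (fun j _ => mul_nonneg (hw j) (pow_nonneg hν.le j))
  simpa [wZ] using h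

/-- SMALL PARAMETER: for `0 < ν ≤ 1` the family mean of `n` is at most `ν Σ n wₙ / w 0`. [folklore] -/
theorem wMean_le_of_le_one (hw : ∀ n, 0 ≤ w n) (hw0 : 0 < w 0)
    (hs : ∀ r : ℝ, 0 < r → Summable fun n => w n * r ^ n) {ν : ℝ} (hν : 0 < ν) (hν1 : ν ≤ 1) :
    wMean w (fun n => (n : ℝ)) ν ≤ ν * (∑' n, w n * (n : ℝ)) / w 0 := by
  rw [wMean_eq_tsum_div_wZ]
  have hZ : w 0 ≤ wZ w ν := w_zero_le_wZ hw hs hν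
  have hS1 : Summable fun n => w n * (n : ℝ) := by
    simpa using summable_mul_pow_mul_nat hw hs one_pos
  have hSν : Summable fun n => w n * ν ^ n * (n : ℝ) := summable_mul_pow_mul_nat hw hs hν
  have hnum : ∑' n, w n * ν ^ n * (n : ℝ) ≤ ν * ∑' n, w n * (n : ℝ) := by
    rw [← tsum_mul_left]
    refine hSν.tsum_le_tsum (fun n => ?_) (hS1.mul_left ν)
    rcases n with _ | k
    · simp
    · have hk : ν ^ (k + 1) ≤ ν := pow_le_of_le_one hν.le hν1 (Nat.succ_ne_zero k)
      calc w (k + 1) * ν ^ (k + 1) * ((k + 1 : ℕ) : ℝ)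
            = ν ^ (k + 1) * (w (k + 1) * ((k + 1 : ℕ) : ℝ)) := by ring
        _ ≤ ν * (w (k + 1) * ((k + 1 : ℕ) : ℝ)) :=
            mul_le_mul_of_nonneg_right hk (by have := hw (k + 1); positivity)
  have hnum0 : 0 ≤ ∑' n, w n * ν ^ n * (n : ℝ) := tsum_nonneg fun n => by have := hw n; positivity
  calc (∑' n, w n * ν ^ n * (n : ℝ)) / wZ w ν ≤ (∑' n, w n * ν ^ n * (n : ℝ)) / w 0 :=
        div_le_div_of_nonneg_left hnum0 hw0 hZ
    _ ≤ ν * (∑' n, w n * (n : ℝ)) / w 0 := div_le_div_of_nonneg_right hnum hw0.le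

/-- LARGE PARAMETER: if `w m₀ > 0`, `U + 1 ≤ m₀`, `ν ≥ 1` and `U Σ_{n<m₀} wₙ ≤ w m₀ ν`, then the family mean
of `n` is at least `U` (split both series at `m₀`). [folklore] -/
theorem le_wMean_of_large (hw : ∀ n, 0 ≤ w n) (hs : ∀ r : ℝ, 0 < r → Summable fun n => w n * r ^ n)
    {m₀ : ℕ} (hm : 0 < w m₀) {U : ℝ} (hU : 0 ≤ U) (hUm : U + 1 ≤ m₀) {ν : ℝ} (hν1 : 1 ≤ ν)
    (hν : U * ∑ n ∈ Finset.range m₀, w n ≤ w m₀ * ν) :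
    U ≤ wMean w (fun n => (n : ℝ)) ν := by
  have hν0 : 0 < ν := one_pos.trans_le hν1
  have hsZ : Summable fun n => w n * ν ^ n := hs ν hν0
  have hsS : Summable fun n => w n * ν ^ n * (n : ℝ) := summable_mul_pow_mul_nat hw hs hν0
  have hsT : Summable fun k => w (k + m₀) * ν ^ (k + m₀) :=
    (summable_nat_add_iff m₀).2 hsZ
  have hsST : Summable fun k => w (k + m₀) * ν ^ (k + m₀) * ((k + m₀ : ℕ) : ℝ) :=
    (summable_nat_add_iff (f := fun n => w n * ν ^ n * (n : ℝ)) m₀).2 hsS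
  set T := ∑' k, w (k + m₀) * ν ^ (k + m₀) with hT
  set F := ∑ n ∈ Finset.range m₀, w n * ν ^ n with hF
  set P := ∑ n ∈ Finset.range m₀, w n with hP
  have hZ : wZ w ν = F + T := (hsZ.sum_add_tsum_nat_add m₀).symm
  have hTm : w m₀ * ν ^ m₀ ≤ T := by
    have h := hsT.le_tsum 0 (fun j _ => mul_nonneg (hw _) (pow_nonneg hν0.le _))
    simpa using h
  have hT0 : 0 ≤ T := (mul_nonneg hm.le (pow_nonneg hν0.le _)).trans hTm
  have hF0 : 0 ≤ F := Finset.sum_nonneg fun n _ => mul_nonneg (hw n) (pow_nonneg hν0.le n)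
  -- the numerator dominates `m₀ T`
  have hS : (m₀ : ℝ) * T ≤ ∑' n, w n * ν ^ n * (n : ℝ) := by
    rw [← hsS.sum_add_tsum_nat_add m₀]
    have h1 : 0 ≤ ∑ n ∈ Finset.range m₀, w n * ν ^ n * (n : ℝ) :=
      Finset.sum_nonneg fun n _ => by have := hw n; positivity
    have h2 : (m₀ : ℝ) * T ≤ ∑' k, w (k + m₀) * ν ^ (k + m₀) * ((k + m₀ : ℕ) : ℝ) := by
      rw [hT, ← tsum_mul_left]
      refine Summable.tsum_le_tsum (fun k => ?_) (hsT.mul_left _) hsST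
      have hk : (m₀ : ℝ) ≤ ((k + m₀ : ℕ) : ℝ) := by exact_mod_cast Nat.le_add_left m₀ k
      calc (m₀ : ℝ) * (w (k + m₀) * ν ^ (k + m₀)) = w (k + m₀) * ν ^ (k + m₀) * (m₀ : ℝ) := by ring
        _ ≤ w (k + m₀) * ν ^ (k + m₀) * ((k + m₀ : ℕ) : ℝ) :=
            mul_le_mul_of_nonneg_left hk (mul_nonneg (hw _) (pow_nonneg hν0.le _))
    linarith
  -- the head of the denominator is small: `U F ≤ T`
  have hFP : F * ν ≤ P * ν ^ m₀ := by
    rw [hF, hP, Finset.sum_mul, Finset.sum_mul]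
    refine Finset.sum_le_sum fun n hn => ?_
    have hn' : n + 1 ≤ m₀ := Finset.mem_range.1 hn
    calc w n * ν ^ n * ν = w n * ν ^ (n + 1) := by ring
      _ ≤ w n * ν ^ m₀ := mul_le_mul_of_nonneg_left (pow_le_pow_right₀ hν1 hn') (hw n)
  have hUF : U * F ≤ T := by
    refine le_of_mul_le_mul_right ?_ hν0
    calc U * F * ν = U * (F * ν) := by ring
      _ ≤ U * (P * ν ^ m₀) := mul_le_mul_of_nonneg_left hFP hU
      _ = U * P * ν ^ m₀ := by ring
      _ ≤ w m₀ * ν * ν ^ m₀ := mul_le_mul_of_nonneg_right hν (pow_nonneg hν0.le _)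
      _ = w m₀ * ν ^ m₀ * ν := by ring
      _ ≤ T * ν := mul_le_mul_of_nonneg_right hTm hν0.le
  have hZpos : 0 < wZ w ν := by
    rw [hZ]; exact add_pos_of_nonneg_of_pos hF0 ((mul_pos hm (pow_pos hν0 _)).trans_le hTm)
  rw [wMean_eq_tsum_div_wZ, le_div_iff₀ hZpos, hZ]
  calc U * (F + T) = U * F + U * T := mul_add _ _ _
    _ ≤ T + U * T := by linarith
    _ = (U + 1) * T := by ring
    _ ≤ (m₀ : ℝ) * T := mul_le_mul_of_nonneg_right hUm hT0
    _ ≤ _ := hS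

/-- **Intermediate value theorem for the family mean.** For weights `w ≥ 0` with `w 0 > 0`, entire
generating function and `w m₀ > 0`, every `mc ∈ [L, U]` with `0 < L` and `U + 1 ≤ m₀` is the family mean of `n`
at some parameter `ν > 0`. [folklore] -/
theorem exists_wMean_eq (hw : ∀ n, 0 ≤ w n) (hw0 : 0 < w 0)
    (hs : ∀ r : ℝ, 0 < r → Summable fun n => w n * r ^ n) {m₀ : ℕ} (hm : 0 < w m₀) {L U : ℝ}
    (hL : 0 < L) (hUm : U + 1 ≤ m₀) {mc : ℝ} (hLmc : L ≤ mc) (hmcU : mc ≤ U) :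
    ∃ ν : ℝ, 0 < ν ∧ wMean w (fun n => (n : ℝ)) ν = mc := by
  have hU : 0 ≤ U := hL.le.trans (hLmc.trans hmcU)
  set S1 := ∑' n, w n * (n : ℝ) with hS1def
  have hS1 : 0 ≤ S1 := tsum_nonneg fun n => mul_nonneg (hw n) (Nat.cast_nonneg n)
  set P := ∑ n ∈ Finset.range m₀, w n with hPdef
  have hP : 0 ≤ P := Finset.sum_nonneg fun n _ => hw n
  set νlo := min 1 (L * w 0 / (S1 + 1)) with hνlo
  set νhi := max 1 (U * P / w m₀) with hνhi
  have hlo0 : 0 < νlo := lt_min one_pos (div_pos (mul_pos hL hw0) (by linarith))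
  have hlo1 : νlo ≤ 1 := min_le_left _ _
  have hhi1 : 1 ≤ νhi := le_max_left _ _
  have hhi0 : 0 < νhi := one_pos.trans_le hhi1
  have hlohi : νlo ≤ νhi := hlo1.trans hhi1
  -- endpoint values
  have hflo : wMean w (fun n => (n : ℝ)) νlo ≤ L := by
    refine (wMean_le_of_le_one hw hw0 hs hlo0 hlo1).trans ?_
    have h1 : νlo * S1 / w 0 ≤ L * w 0 / (S1 + 1) * S1 / w 0 :=
      div_le_div_of_nonneg_right (mul_le_mul_of_nonneg_right (min_le_right _ _) hS1) hw0.le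
    refine h1.trans ?_
    have h2 : L * w 0 / (S1 + 1) * S1 / w 0 = L * (S1 / (S1 + 1)) := by
      field_simp
    rw [h2]
    calc L * (S1 / (S1 + 1)) ≤ L * 1 :=
          mul_le_mul_of_nonneg_left ((div_le_one (by linarith)).2 (by linarith)) hL.le
      _ = L := mul_one L
  have hfhi : U ≤ wMean w (fun n => (n : ℝ)) νhi := by
    refine le_wMean_of_large hw hs hm hU hUm hhi1 ?_
    calc U * P = w m₀ * (U * P / w m₀) := by field_simp
      _ ≤ w m₀ * νhi := mul_le_mul_of_nonneg_left (le_max_right _ _) hm.le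
  -- continuity on `[νlo, νhi]`
  have hcont : ContinuousOn (wMean w (fun n => (n : ℝ))) (Icc νlo νhi) := by
    have he : wMean w (fun n => (n : ℝ)) =
        fun ν => (∑' n, w n * ν ^ n * (n : ℝ)) / (∑' n, w n * ν ^ n * 1) := by
      funext ν
      rw [wMean_eq_tsum_div_wZ]
      simp [wZ]
    rw [he]
    refine ContinuousOn.div ?_ ?_ ?_
    · refine (continuousOn_tsum_weights hw (fun n => (n : ℝ)) ?_).mono (Icc_subset_Icc_left hlo0.le)
      simpa [Nat.abs_cast] using summable_mul_pow_mul_nat hw hs hhi0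
    · refine (continuousOn_tsum_weights hw (fun _ => (1 : ℝ)) ?_).mono (Icc_subset_Icc_left hlo0.le)
      simpa using hs νhi hhi0
    · intro ν hν
      have hν0 : 0 < ν := hlo0.trans_le hν.1
      have h := w_zero_le_wZ hw hs hν0
      unfold wZ at h
      simp only [mul_one]
      exact (hw0.trans_le h).ne'
  -- intermediate value theorem
  have hmem : mc ∈ Icc (wMean w (fun n => (n : ℝ)) νlo) (wMean w (fun n => (n : ℝ)) νhi) :=
    ⟨hflo.trans hLmc, hmcU.trans hfhi⟩
  obtain ⟨ν, hν, hνeq⟩ := intermediate_value_Icc hlohi hcont hmem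
  exact ⟨ν, hlo0.trans_le hν.1, hνeq⟩

end Abstract

/-! ### The hard-sphere canonical weights -/

section HardSphere

variable {a θ : T3 → ℝ} {u : T3 → V3}

/-- Without particles the configurational partition function is `1`. [folklore] -/
theorem posPartition_zero (a : T3 → ℝ) (ε : ℝ) : posPartition a ε 0 = 1 := by
  unfold posPartition posWeight
  have h : ∀ x : Fin 0 → T3, x ∈ posDomain ε 0 := fun x i => i.elim0
  simp [Set.indicator_of_mem (h _)]

/-- `Z_pos(a, ε, n) ≤ Aⁿ` for a continuous activity `0 ≤ a ≤ A` (Haar probability measure). [folklore] -/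
theorem posPartition_le_pow (ha : Continuous a) (ha0 : ∀ x, 0 ≤ a x) {A : ℝ} (hA : ∀ x, a x ≤ A)
    (ε : ℝ) (n : ℕ) : posPartition a ε n ≤ A ^ n := by
  unfold posPartition
  calc ∫ x, posWeight a ε n x ≤ ∫ _x : Fin n → T3, A ^ n :=
        integral_mono (integrable_posWeight ha ha0 ε n) (integrable_const _)
          fun x => posWeight_le_pow ha0 hA ε x
    _ = A ^ n := by simp

/-- The canonical weights of a local Gibbs profile are the configurational ones: `wₙ = Z_pos(a, ε_N, n)/n!`
(`canonicalPartition_eq_posPartition`). [folklore] -/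
theorem canonicalWeights_eq (ha : Continuous a) (hθ : Continuous θ) (hu : Continuous u)
    (ha0 : ∀ x, 0 ≤ a x) (hθ0 : ∀ x, 0 < θ x) (σ₁ : ℝ) (N n : ℕ) :
    canonicalWeights σ₁ (localGibbsProfile a u θ) N n =
      posPartition a (hsDiameter σ₁ N) n / (n.factorial : ℝ) := by
  unfold canonicalWeights
  rw [show G3 = Torus.geometry (Fin 3) from rfl, canonicalPartition_eq_posPartition ha hθ hu ha0 hθ0]

/-- The canonical weights are nonnegative. [folklore] -/
theorem canonicalWeights_nonneg (ha : Continuous a) (hθ : Continuous θ) (hu : Continuous u)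
    (ha0 : ∀ x, 0 ≤ a x) (hθ0 : ∀ x, 0 < θ x) (σ₁ : ℝ) (N n : ℕ) :
    0 ≤ canonicalWeights σ₁ (localGibbsProfile a u θ) N n := by
  rw [canonicalWeights_eq ha hθ hu ha0 hθ0]
  exact div_nonneg (posPartition_nonneg ha0 _ _) (Nat.cast_nonneg _)

/-- The zeroth canonical weight is `1`. [folklore] -/
theorem canonicalWeights_zero (ha : Continuous a) (hθ : Continuous θ) (hu : Continuous u)
    (ha0 : ∀ x, 0 ≤ a x) (hθ0 : ∀ x, 0 < θ x) (σ₁ : ℝ) (N : ℕ) :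
    canonicalWeights σ₁ (localGibbsProfile a u θ) N 0 = 1 := by
  rw [canonicalWeights_eq ha hθ hu ha0 hθ0, posPartition_zero]
  simp

/-- The generating function of the canonical weights is entire: `Σ wₙ rⁿ < ∞` for every `r > 0`
(`wₙ ≤ (sup a)ⁿ / n!`). [folklore] -/
theorem summable_canonicalWeights_mul_pow (ha : Continuous a) (hθ : Continuous θ) (hu : Continuous u)
    (ha0 : ∀ x, 0 ≤ a x) (hθ0 : ∀ x, 0 < θ x) (σ₁ : ℝ) (N : ℕ) :
    ∀ r : ℝ, 0 < r → Summable fun n => canonicalWeights σ₁ (localGibbsProfile a u θ) N n * r ^ n := by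
  intro r hr
  obtain ⟨A, -, hA⟩ := exists_forall_abs_le_of_continuous ha
  have hA' : ∀ x, a x ≤ A := fun x => (le_abs_self _).trans (hA x)
  refine Summable.of_nonneg_of_le (fun n => ?_) (fun n => ?_) (Real.summable_pow_div_factorial (A * r))
  · exact mul_nonneg (canonicalWeights_nonneg ha hθ hu ha0 hθ0 σ₁ N n) (pow_nonneg hr.le n)
  · rw [canonicalWeights_eq ha hθ hu ha0 hθ0, mul_pow, div_mul_eq_mul_div]
    exact div_le_div_of_nonneg_right
      (mul_le_mul_of_nonneg_right (posPartition_le_pow ha ha0 hA' _ n) (pow_nonneg hr.le n))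
      (Nat.cast_nonneg _)

/-- `k + 1` spheres of diameter `hsDiameter σ₁ N` fit on the torus as soon as `σ₁³ (k+1) ≤ (N+1)/8`:
then the `(k+1)`-st canonical weight is positive (`posPartition_pos` at reduced diameter `1/2` and
`posPartition_antitone_diam`). [folklore] -/
theorem canonicalWeights_pos_of_fit (ha : Continuous a) (hθ : Continuous θ) (hu : Continuous u)
    (ha0 : ∀ x, 0 < a x) (hθ0 : ∀ x, 0 < θ x) {σ₁ : ℝ} {N k : ℕ}
    (hfit : σ₁ ^ 3 * ((k + 1 : ℕ) : ℝ) ≤ (1 / 2) ^ 3 * ((N + 1 : ℕ) : ℝ)) :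
    0 < canonicalWeights σ₁ (localGibbsProfile a u θ) N (k + 1) := by
  obtain ⟨A, -, hA⟩ := exists_forall_abs_le_of_continuous ha
  have hA' : ∀ x, a x ≤ A := fun x => (le_abs_self _).trans (hA x)
  have ha0' : ∀ x, 0 ≤ a x := fun x => (ha0 x).le
  have hdiam : hsDiameter σ₁ N ≤ hsDiameter (1 / 2) k := by
    refine le_of_pow_le_pow_left₀ (by norm_num : (3 : ℕ) ≠ 0) (hsDiameter_pos (by norm_num) k).le ?_
    rw [hsDiameter_pow_three, hsDiameter_pow_three,
      div_le_div_iff₀ (by positivity) (by positivity)]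
    exact hfit
  rw [canonicalWeights_eq ha hθ hu ha0' hθ0]
  refine div_pos ?_ (by positivity)
  exact (posPartition_pos ha ha0 (le_refl (1 / 2 : ℝ)) k).trans_le
    (NearConstantShortTimeHL.posPartition_antitone_diam ha.measurable ha0' hA' hdiam (k + 1))

end HardSphere

/-! ### The stub -/

/-- **STUB `stub_countIVT`: every centre of the mean-count window is a mean count.** For continuous profiles
`a₂, θ₂ > 0`, `u₂`, with `σ₀ = 1/4`, `κ = 1/2`, `N₀ = 0`: for `0 < σ₁, σ₂ < σ₀` and every `N`, every
`mc ∈ [(1−κ)(σ₂/σ₁)³(N+1), (1+κ)(σ₂/σ₁)³(N+1)]` equals `meanCount σ₁ (localGibbsProfile a₂ u₂ θ₂) μ N` for some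
`μ > 0` (intermediate value theorem for the continuous family mean of the entire, nonnegative canonical weights
with `w 0 = 1` and `w (⌈(1+κ)(σ₂/σ₁)³(N+1)⌉₊ + 1) > 0`). [folklore] -/
theorem stub_countIVT :
    ∀ (a₂ θ₂ : T3 → ℝ) (u₂ : T3 → V3), Continuous a₂ → Continuous θ₂ → Continuous u₂ →
      (∀ x, 0 < a₂ x) → (∀ x, 0 < θ₂ x) →
    ∃ σ₀ : ℝ, 0 < σ₀ ∧ ∀ (σ₁ σ₂ : ℝ), 0 < σ₁ → σ₁ < σ₀ → 0 < σ₂ → σ₂ < σ₀ →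
    ∃ κ : ℝ, 0 < κ ∧ ∃ N₀ : ℕ, ∀ N : ℕ, N₀ ≤ N →
      ∀ mc : ℝ, (1 - κ) * ((σ₂ / σ₁) ^ 3 * ((N + 1 : ℕ) : ℝ)) ≤ mc →
        mc ≤ (1 + κ) * ((σ₂ / σ₁) ^ 3 * ((N + 1 : ℕ) : ℝ)) →
        ∃ μ : ℝ, 0 < μ ∧ meanCount σ₁ (localGibbsProfile a₂ u₂ θ₂) μ N = mc := by
  intro a₂ θ₂ u₂ ha hθ hu ha0 hθ0
  refine ⟨1 / 4, by norm_num, ?_⟩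
  intro σ₁ σ₂ hσ₁ hσ₁4 hσ₂ hσ₂4
  refine ⟨1 / 2, by norm_num, 0, fun N _ mc hlo hhi => ?_⟩
  have ha0' : ∀ x, 0 ≤ a₂ x := fun x => (ha0 x).le
  set q : ℝ := (σ₂ / σ₁) ^ 3 * ((N + 1 : ℕ) : ℝ) with hq
  have hq0 : 0 < q := by positivity
  set U : ℝ := (1 + 1 / 2) * q with hU
  have hU0 : 0 ≤ U := by positivity
  set k : ℕ := ⌈U⌉₊ with hk
  -- the four weight facts
  have hw : ∀ n, 0 ≤ canonicalWeights σ₁ (localGibbsProfile a₂ u₂ θ₂) N n :=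
    canonicalWeights_nonneg ha hθ hu ha0' hθ0 σ₁ N
  have hw0 : 0 < canonicalWeights σ₁ (localGibbsProfile a₂ u₂ θ₂) N 0 := by
    rw [canonicalWeights_zero ha hθ hu ha0' hθ0]; exact one_pos
  have hs := summable_canonicalWeights_mul_pow ha hθ hu ha0' hθ0 σ₁ N
  have hfit : σ₁ ^ 3 * ((k + 1 : ℕ) : ℝ) ≤ (1 / 2) ^ 3 * ((N + 1 : ℕ) : ℝ) := by
    have hkU : ((k + 1 : ℕ) : ℝ) ≤ U + 2 := by
      push_cast
      linarith [Nat.ceil_lt_add_one hU0]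
    have hc3 : σ₁ ^ 3 * q = σ₂ ^ 3 * ((N + 1 : ℕ) : ℝ) := by
      rw [hq, div_pow]; field_simp
    have hσ₁3 : σ₁ ^ 3 ≤ (1 / 4) ^ 3 := pow_le_pow_left₀ hσ₁.le hσ₁4.le 3
    have hσ₂3 : σ₂ ^ 3 ≤ (1 / 4) ^ 3 := pow_le_pow_left₀ hσ₂.le hσ₂4.le 3
    have h1N : (1 : ℝ) ≤ ((N + 1 : ℕ) : ℝ) := by exact_mod_cast Nat.succ_le_succ (Nat.zero_le N)
    have hN0 : (0 : ℝ) ≤ ((N + 1 : ℕ) : ℝ) := by positivity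
    calc σ₁ ^ 3 * ((k + 1 : ℕ) : ℝ) ≤ σ₁ ^ 3 * (U + 2) := mul_le_mul_of_nonneg_left hkU (by positivity)
      _ = (1 + 1 / 2) * (σ₂ ^ 3 * ((N + 1 : ℕ) : ℝ)) + 2 * σ₁ ^ 3 := by rw [hU, ← hc3]; ring
      _ ≤ (1 + 1 / 2) * ((1 / 4) ^ 3 * ((N + 1 : ℕ) : ℝ)) + 2 * ((1 / 4) ^ 3 * ((N + 1 : ℕ) : ℝ)) := by
          refine add_le_add (mul_le_mul_of_nonneg_left (mul_le_mul_of_nonneg_right hσ₂3 hN0) (by norm_num))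
            (mul_le_mul_of_nonneg_left ?_ (by norm_num))
          calc σ₁ ^ 3 ≤ (1 / 4) ^ 3 := hσ₁3
            _ = (1 / 4) ^ 3 * 1 := (mul_one _).symm
            _ ≤ (1 / 4) ^ 3 * ((N + 1 : ℕ) : ℝ) := mul_le_mul_of_nonneg_left h1N (by positivity)
      _ ≤ (1 / 2) ^ 3 * ((N + 1 : ℕ) : ℝ) := by nlinarith [hN0]
  have hm : 0 < canonicalWeights σ₁ (localGibbsProfile a₂ u₂ θ₂) N (k + 1) :=
    canonicalWeights_pos_of_fit ha hθ hu ha0 hθ0 hfit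
  have hUm : U + 1 ≤ ((k + 1 : ℕ) : ℝ) := by
    push_cast
    linarith [Nat.le_ceil U]
  have hL : 0 < (1 - 1 / 2) * q := by positivity
  obtain ⟨μ, hμ, h⟩ := exists_wMean_eq hw hw0 hs hm hL hUm hlo hhi
  exact ⟨μ, hμ, h⟩

end

end Summit.AtomisticToContinuum.HydrodynamicLimit.Theorems.LightConeInLawSVC.CountIVT
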